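import Mathlib

/-! # `Balaban1983to89.SchurTest` — the finite Schur test (ℓ¹ × ℓ∞ ⇒ ℓ²) used to certify B9 (3.46), entries 1–3

CITATION HEADER. Supports the adversarial reading (unit `b2b-balaban-adv1`, cell pub-balaban) of
T. Balaban, *Propagators for lattice gauge theories in a background field*, Commun. Math. Phys. 99 (1985) 389–434
[`Balaban1985BackgroundPropagators`], Theorem 3.1, inequality (3.46): the six L² entries
`[(L^jη)², L^jη, L^jη, 1, 1, 1]` for `G′, ∇G′, G′∇*, ∇G′∇*, …`.  WHAT IS PRINTED (p. 410): the proof of Theorem 3.7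
(the random-walk expansion (3.90), from which (3.42)–(3.47) follow, p. 410 "Theorem 3.7 implies that all the
inequalities (3.42)–(3.47) hold for G′") is delegated — "The arguments are exactly the same as in proofs of Proposition 1.2
[3] and Proposition 2.2 [4]" — where Proposition 2.2 of [4] = CMP 96 (1984) 223, (2.67), contains NO L² entry, while
Proposition 1.2 of [3] = CMP 95 (1984) 17, (1.114) p. 36, IS a six-entry L² inequality (`ζG`, `ζ∇G`, `ζG∇*`, `ζ∇G∇*`,
`ζ∇∇G`, `ζG∇*∇*`) in the U = 1, single-domain setting of [3] (GAPS G-ref1-5, re-scoping G-A1-1: a printed base-case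
STATEMENT for entries 4–6 exists; unwritten is the transfer to G′(U) on {Ω_j} through (3.90) in L² norms, and [3]'s
own proof of (1.114) is the b05 sub-cell's census).  WHAT THIS FILE CERTIFIES: for any real matrix
`T` on a finite index set, `‖T‖²_{2→2} ≤ ‖T‖_{1→1} ‖T‖_{∞→∞}` (row/column absolute sums).  Applied to the blocks
`χ_{Δ(y)} G′ χ_{Δ(y′)}` (and `χ ∇G′ χ`, `χ G′∇* χ`) with the sup bounds (3.42) and their transposes (G′ is symmetric for
unitary `U`, `(∇G′)ᵀ = G′∇*`), this DERIVES entries 1–3 of (3.46) from the printed (3.42) with the constant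
`B₀ (L^jη)^{a} (L^{j′}η)^{b} e^{−δ₀ d(y,y′)}` (a+b = 2, 1, 1).  Entries 4–6 (`∇G′∇*` and the `Q`-blocks) have no
`∞→∞` bound among (3.42)–(3.45) and are NOT derivable this way (GAPS rows G-A1-1 / G-ref1-5 / G-A1-1a; consumer trace B10–B16: no downstream
step cites them — dormant).  Elementary; [folklore] (Schur test,
e.g. Halmos–Sunder, *Bounded Integral Operators on L² Spaces*, Thm 5.2). -/

namespace Literature.MathematicalPhysics.QuantumFieldTheory.Balaban1983to89.SchurTest

open Finset

variable {ι : Type*} [Fintype ι]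

/-- Row-wise Cauchy–Schwarz with the weights `|T i j|`. [folklore] -/
theorem row_sq_le (T : ι → ι → ℝ) (x : ι → ℝ) (i : ι) :
    (∑ j, T i j * x j) ^ 2 ≤ (∑ j, |T i j|) * ∑ j, |T i j| * x j ^ 2 := by
  have h1 : (∑ j, T i j * x j) ^ 2 ≤ (∑ j, |T i j| * |x j|) ^ 2 := by
    have ha : |∑ j, T i j * x j| ≤ ∑ j, |T i j| * |x j| := by
      calc |∑ j, T i j * x j| ≤ ∑ j, |T i j * x j| := Finset.abs_sum_le_sum_abs _ _
        _ = ∑ j, |T i j| * |x j| := by simp [abs_mul]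
    have hb : 0 ≤ ∑ j, |T i j| * |x j| := Finset.sum_nonneg fun j _ => by positivity
    calc (∑ j, T i j * x j) ^ 2 = |∑ j, T i j * x j| ^ 2 := (sq_abs _).symm
      _ ≤ (∑ j, |T i j| * |x j|) ^ 2 := by gcongr
  have h2 : (∑ j, |T i j| * |x j|) ^ 2 ≤ (∑ j, |T i j|) * ∑ j, |T i j| * x j ^ 2 := by
    have hcs := Finset.sum_mul_sq_le_sq_mul_sq (univ : Finset ι)
      (fun j => Real.sqrt |T i j|) (fun j => Real.sqrt |T i j| * |x j|)
    have e1 : ∀ j, Real.sqrt |T i j| * (Real.sqrt |T i j| * |x j|) = |T i j| * |x j| := by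
      intro j; rw [← mul_assoc, Real.mul_self_sqrt (abs_nonneg _)]
    have e2 : ∀ j, Real.sqrt |T i j| ^ 2 = |T i j| := fun j => Real.sq_sqrt (abs_nonneg _)
    have e3 : ∀ j, (Real.sqrt |T i j| * |x j|) ^ 2 = |T i j| * x j ^ 2 := by
      intro j; rw [mul_pow, Real.sq_sqrt (abs_nonneg _), sq_abs]
    simp only [e1, e2, e3] at hcs
    exact hcs
  exact h1.trans h2

/-- **Finite Schur test.**  If every row of `|T|` sums to at most `R` and every column to at most `C`, then
`‖T x‖₂² ≤ R C ‖x‖₂²`. [folklore] -/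
theorem sum_sq_le (T : ι → ι → ℝ) (x : ι → ℝ) {R C : ℝ}
    (hR : ∀ i, ∑ j, |T i j| ≤ R) (hC : ∀ j, ∑ i, |T i j| ≤ C) :
    ∑ i, (∑ j, T i j * x j) ^ 2 ≤ R * C * ∑ j, x j ^ 2 := by
  rcases isEmpty_or_nonempty ι with h | ⟨⟨i₀⟩⟩
  · simp
  have hR0 : 0 ≤ R := le_trans (Finset.sum_nonneg fun j _ => abs_nonneg _) (hR i₀)
  calc ∑ i, (∑ j, T i j * x j) ^ 2
      ≤ ∑ i, (∑ j, |T i j|) * ∑ j, |T i j| * x j ^ 2 := Finset.sum_le_sum fun i _ => row_sq_le T x i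
    _ ≤ ∑ i, R * ∑ j, |T i j| * x j ^ 2 := by
        refine Finset.sum_le_sum fun i _ => ?_
        exact mul_le_mul_of_nonneg_right (hR i) (Finset.sum_nonneg fun j _ => by positivity)
    _ = R * ∑ j, x j ^ 2 * ∑ i, |T i j| := by
        rw [← Finset.mul_sum, Finset.sum_comm]
        congr 1
        refine Finset.sum_congr rfl fun j _ => ?_
        rw [Finset.mul_sum]
        refine Finset.sum_congr rfl fun i _ => ?_
        ring
    _ ≤ R * ∑ j, x j ^ 2 * C := by
        refine mul_le_mul_of_nonneg_left (Finset.sum_le_sum fun j _ => ?_) hR0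
        exact mul_le_mul_of_nonneg_left (hC j) (sq_nonneg _)
    _ = R * C * ∑ j, x j ^ 2 := by rw [← Finset.sum_mul]; ring

end Literature.MathematicalPhysics.QuantumFieldTheory.Balaban1983to89.SchurTest
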